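import Literature.Barriers.QuantumFields.EguchiKawaiBreakdownLowerBound
import HarnessLib

/-!
# The centre-stabilised single-site model: the Eguchi–Kawai barrier is specific to the undeformed action

Fourth file of the unit on the named fact `Literature.Barriers.QuantumFields.EguchiKawaiBreakdown`
(`Literature/Barriers/QuantumFields/`, D-0021; barrier AUDIT, scope narrowing). The barrier
records, after Bhanot–Heller–Neuberger 1982 as printed by Makeenko (§14.3 p. 246, §14.5 p. 251),
that the `U(1)^d` centre symmetry of the NAIVE Eguchi–Kawai single-site model — Wilson-type
reduced action (14.38), Boltzmann weight `e^{−N² b S_R}` (14.40), no twist, no matter, no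
double-trace term — is spontaneously broken at weak coupling for `d ≥ 3`: the open-line order
parameter `⟨|(1/N) tr U_μ|²⟩_EK` does not tend to `0` as `N → ∞` for `b > b₀`.

Its catalogue tags `single-site-model`, `large-n-volume-reduction`, `large-n-volume-independence`
are wider than what the printed one-loop argument (14.77) covers. The later literature isolates
the mechanism — volume independence at `N = ∞` holds exactly when the centre symmetry is unbroken
[cite: KovtunUnsalYaffe2007, §1–2 (pp. 1–2, 9)] — and evades the breaking at WEAK coupling inside
the single-site class: by twisting with flux `k ∼ √N` [cite: GonzalezarroyoOkawa2010, §4] (the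
continuum large-`N` string tension was then computed from the one-site TEK model at `N = 841`
[cite: GonzalezarroyoOkawa2013, abstract, p. 4]), by adjoint fermions with periodic boundary
conditions [cite: KovtunUnsalYaffe2007, abstract] [cite: BringoltzSharpe2009, abstract], and by
the CENTRE-STABILISING DOUBLE-TRACE DEFORMATION of Ünsal–Yaffe: "We add double trace terms to the
action which prevent spontaneous breaking of center symmetry … a single-site matrix model of the
deformed theory will reproduce properties of ordinary Yang–Mills theory in infinite volume …
Unlike the original Eguchi-Kawai model, its twisted variant, and the partial reduction …, the
equivalence to deformed YM theory remains valid in the limit of zero compactification radius,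
irrespective of the value of the (bare) gauge coupling" [cite: UnsalYaffe2008, §1 (pp. 2–4)].

This file formalises the last evasion for the order parameter the barrier is stated with, and
PROVES an `N`-uniform, coupling-by-coupling form of it from the left invariance of Haar measure
alone (no perturbation theory):

* `ekPolyakovSq U = Σ_μ |(1/N) tr U_μ|²` and the deformed single-site weight
  `ekDeformedWeight N b h U = exp(−N² b S_R[U] − N² h Σ_μ |(1/N) tr U_μ|²)` — the `n = 1` term of
  the Ünsal–Yaffe deformation `P[Ω] = Σ_n a_n |tr Ω^n|²` with 't Hooft scaling (`a_1 = h` fixed as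
  `N → ∞`), applied to every reduced link; `ekDeformedExpectation`, `ekDeformedOrderParameter`.
* `h = 0` IS the barrier's model: `ekDeformedWeight_zero_right`,
  `ekDeformedOrderParameter_zero_right : ekDeformedOrderParameter d N b 0 μ = ekOrderParameter d N b μ`.
* The deformation keeps every symmetry the barrier's `because:` clause rests on:
  `ekPolyakovSq_centerFlip`, `ekDeformedWeight_centerFlip` (centre flip (14.41) with `Z_μ = −1`).
* **Finite-`N` bound (`ekDeformedOrderParameter_le`).** For `N ≥ 1`, `b, h ≥ 0`, `ε > 0`,
  `0 < η ≤ 1` and every direction,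
  `⟨|(1/N) tr U_μ|²⟩_{b,h} ≤ ε + exp(−N²(hε − h d (1/N + η)² − 4 b d² η² − d log((2π+1)/η)))`.
  Proof: pointwise `|openLine|² w ≤ ε w + e^{−N² h ε}` (split on `Σ_μ |openLine|² ≤ ε`; the weight
  is `≤ e^{−N² h Σ|openLine|²}` since `S_R ≥ 0`), and the deformed partition function is bounded
  BELOW by restricting to the operator-norm box of radius `η` around the centre-symmetric commuting
  tuple `U_μ = diag(±1)` (`signDiag`, `|tr| ≤ 1`): there `S_R ≤ 4d²η²`
  (`ekAction_le_of_near_const`), `|(1/N) tr U_μ| ≤ 1/N + η` (`norm_openLine_le_of_near`), and the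
  box has product-Haar measure `≥ (η/(2π+1))^{dN²}` (`haar_unitaryOpBall_ge`, the `N`-uniform
  small-ball bound of `UnitaryHaarSmallBall.lean`).
* **Evasion at every coupling (`ekDeformed_openLines_eventually_le`).** For every `d`, every
  `b ≥ 0` and every `ε > 0` there is `h₀` such that for all `h ≥ h₀` and every direction the deformed
  order parameter is `≤ ε` for all large `N`. Contrast (`ekDeformed_contrast`): under the named fact,
  for `d ≥ 3` and `b > b₀` the `h = 0` member of the same one-parameter family of single-site
  models has an order parameter NOT tending to `0`, while the `h ≥ h₀(b, ε)` members have it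
  eventually `≤ ε` — unconditionally. The `U(1)^d` obstruction is a property of the undeformed
  action (14.38)/(14.40), not of single-site reduction as such.

## Scope (what is and is not proved)

* Only the `n = 1` double-trace term is added, and only the barrier's own order parameter (the
  elementary open line) is controlled. Ünsal–Yaffe stress that `|tr Ω|²` alone "cannot prevent
  `ℤ_N` breaking to `ℤ_2` … with `tr(Ω²)` as an order parameter" [cite: UnsalYaffe2008, §1 (p. 3)];
  indeed the symmetric tuple used in the proof, `diag(±1)`, has `|tr U²/N| = 1`. Controlling the
  windings `n ≤ K` needs the terms `n ≤ K` (same argument around the clock matrix `diag(e^{2πij/K'})`,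
  not done here); the barrier's standing hypothesis `EKOpenLinesVanish` only involves `n = 1`.
* The bound is `≤ ε` at `h ≥ h₀(d, b, ε)` with `h₀` growing linearly in `b` and like `log(1/ε)/ε`;
  the physics claim is stronger (exact vanishing at fixed `h = O(1)`, by a one-loop comparison).
  Nothing here asserts the reduction identity (14.45) for the deformed model.

## References

* M. Ünsal, L. G. Yaffe, Phys. Rev. D 78 (2008) 065035, §1–2 (arXiv:0803.0344, pp. 2–5).
* P. Kovtun, M. Ünsal, L. G. Yaffe, JHEP 06 (2007) 019, §1–2.
* A. González-Arroyo, M. Okawa, JHEP 07 (2010) 043, §4; Phys. Lett. B 718 (2013) 1524.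
* B. Bringoltz, S. R. Sharpe, Phys. Rev. D 80 (2009) 065031.
* Y. Makeenko, *Methods of Contemporary Gauge Theory* (CUP, reissue 2023), §14.3 (PDF pp.
  244–247), §14.5 (p. 251), §15.3 (p. 268: "the twisted Eguchi–Kawai model … `U(1)^d` symmetry …
  is not broken for all values of the coupling").
-/

noncomputable section

open MeasureTheory Filter Topology
open scoped Real Matrix Matrix.Norms.L2Operator ENNReal

namespace Literature.Barriers.QuantumFields

variable {d N : ℕ}

/-! ### The centre-stabilised (double-trace deformed) single-site model -/

/-- The centre-breaking functional `P[U] = Σ_μ |(1/N) tr U_μ|²` — the sum over the reduced links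
of the `n = 1` double-trace term `|tr Ω|²/N²` of the Ünsal–Yaffe deformation potential
`P[Ω] = Σ_n a_n |tr Ω^n|²`. [cite: UnsalYaffe2008, §1 eq. (1.3) (p. 3)] -/
def ekPolyakovSq (U : EKConfig d N) : ℝ := ∑ μ, ‖openLine μ U‖ ^ 2

/-- `P[U] ≥ 0`. [folklore] -/
theorem ekPolyakovSq_nonneg (U : EKConfig d N) : 0 ≤ ekPolyakovSq U :=
  Finset.sum_nonneg fun _ _ => by positivity

/-- Each open line is dominated by `P[U]`. [folklore] -/
theorem sq_norm_openLine_le_ekPolyakovSq (U : EKConfig d N) (μ : Fin d) :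
    ‖openLine μ U‖ ^ 2 ≤ ekPolyakovSq U :=
  Finset.single_le_sum (f := fun ν => ‖openLine ν U‖ ^ 2) (fun _ _ => by positivity)
    (Finset.mem_univ μ)

/-- `P` is continuous. [folklore] -/
theorem continuous_ekPolyakovSq : Continuous fun U : EKConfig d N => ekPolyakovSq U :=
  continuous_finsetSum _ fun μ _ => (continuous_openLine μ).norm.pow 2

/-- **The deformed (centre-stabilised) single-site Boltzmann weight**
`exp(−N² b S_R[U] − N² h Σ_μ |(1/N) tr U_μ|²)`: the Eguchi–Kawai weight (14.40) at inverse 't Hooft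
coupling `b` times the `n = 1` Ünsal–Yaffe double-trace factor with 't Hooft-scaled strength `h`
("We add double trace terms to the action which prevent spontaneous breaking of center
symmetry"). [cite: UnsalYaffe2008, §1 (pp. 2–3), eq. (1.2)–(1.3)] [cite: Makeenko2023, §14.3 (14.40) (PDF p. 245)] -/
def ekDeformedWeight (N : ℕ) (b h : ℝ) (U : EKConfig d N) : ℝ :=
  Real.exp (-((N : ℝ) ^ 2 * b) * ekAction U - (N : ℝ) ^ 2 * h * ekPolyakovSq U)

/-- Product form: the deformed weight is the EK weight times `exp(−N² h P[U])`. [folklore] -/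
theorem ekDeformedWeight_eq_mul (N : ℕ) (b h : ℝ) (U : EKConfig d N) :
    ekDeformedWeight N b h U = ekWeight N b U * Real.exp (-((N : ℝ) ^ 2 * h * ekPolyakovSq U)) := by
  rw [ekDeformedWeight, ekWeight, ← Real.exp_add]
  ring_nf

/-- **At `h = 0` the deformed model IS the Eguchi–Kawai model of the barrier.** [folklore] -/
@[simp] theorem ekDeformedWeight_zero_right (N : ℕ) (b : ℝ) (U : EKConfig d N) :
    ekDeformedWeight N b 0 U = ekWeight N b U := by
  simp [ekDeformedWeight, ekWeight]

/-- The deformed weight is positive. [folklore] -/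
theorem ekDeformedWeight_pos (N : ℕ) (b h : ℝ) (U : EKConfig d N) : 0 < ekDeformedWeight N b h U :=
  Real.exp_pos _

/-- The deformed weight is continuous. [folklore] -/
theorem continuous_ekDeformedWeight (N : ℕ) (b h : ℝ) :
    Continuous fun U : EKConfig d N => ekDeformedWeight N b h U := by
  unfold ekDeformedWeight
  exact Real.continuous_exp.comp
    ((continuous_const.mul continuous_ekAction).sub (continuous_const.mul continuous_ekPolyakovSq))

/-- The deformed weight is integrable. [folklore] -/
theorem integrable_ekDeformedWeight (N : ℕ) (b h : ℝ) :
    Integrable (fun U : EKConfig d N => ekDeformedWeight N b h U) (ekHaar d N) :=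
  integrable_of_continuous_config (continuous_ekDeformedWeight N b h)

/-- For `b, h ≥ 0` the deformed weight is at most `exp(−N² h P[U])` (the action is `≥ 0`). [folklore] -/
theorem ekDeformedWeight_le_exp (N : ℕ) {b h : ℝ} (hb : 0 ≤ b) (U : EKConfig d N) :
    ekDeformedWeight N b h U ≤ Real.exp (-((N : ℝ) ^ 2 * h * ekPolyakovSq U)) := by
  rw [ekDeformedWeight, Real.exp_le_exp]
  have hS := ekAction_nonneg U
  have : 0 ≤ (N : ℝ) ^ 2 * b * ekAction U := by positivity
  linarith

/-- **The deformed partition function is positive.** [folklore] -/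
theorem ekDeformedPartition_pos (d N : ℕ) (b h : ℝ) :
    0 < ∫ U, ekDeformedWeight N b h U ∂ekHaar d N := by
  unfold ekDeformedWeight
  exact integral_exp_pos (integrable_ekDeformedWeight (d := d) N b h)

/-- Expectations in the deformed single-site model. [cite: UnsalYaffe2008, §1 (p. 4)] -/
def ekDeformedExpectation (N : ℕ) (b h : ℝ) (F : EKConfig d N → ℝ) : ℝ :=
  (∫ U, F U * ekDeformedWeight N b h U ∂ekHaar d N) / (∫ U, ekDeformedWeight N b h U ∂ekHaar d N)

/-- The barrier's order parameter `⟨|(1/N) tr U_μ|²⟩` in the deformed model at inverse 't Hooft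
coupling `b` and deformation strength `h`. [cite: UnsalYaffe2008, §1 (p. 3)] -/
def ekDeformedOrderParameter (d N : ℕ) (b h : ℝ) (μ : Fin d) : ℝ :=
  ekDeformedExpectation N b h (fun U : EKConfig d N => ‖openLine μ U‖ ^ 2)

/-- **At `h = 0` the deformed order parameter is the barrier's order parameter.** [folklore] -/
theorem ekDeformedOrderParameter_zero_right (d N : ℕ) (b : ℝ) (μ : Fin d) :
    ekDeformedOrderParameter d N b 0 μ = ekOrderParameter d N b μ := by
  simp [ekDeformedOrderParameter, ekDeformedExpectation, ekOrderParameter, ekExpectation]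

/-- The deformed order parameter is non-negative. [folklore] -/
theorem ekDeformedOrderParameter_nonneg (d N : ℕ) (b h : ℝ) (μ : Fin d) :
    0 ≤ ekDeformedOrderParameter d N b h μ := by
  unfold ekDeformedOrderParameter ekDeformedExpectation
  refine div_nonneg (integral_nonneg fun U => ?_) (ekDeformedPartition_pos d N b h).le
  exact mul_nonneg (by positivity) (Real.exp_pos _).le

/-! ### The deformation keeps the centre symmetry -/

/-- Links other than the flipped one keep their open line. [folklore] -/
theorem openLine_centerFlip_ne {μ ν : Fin d} (h : ν ≠ μ) (U : EKConfig d N) :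
    openLine ν (centerFlip μ U) = openLine ν U := by
  unfold openLine
  rw [centerFlip_apply_ne h]

/-- `P` is centre symmetric (each `|tr U_μ|²` is blind to the phase of `U_μ`). [cite: UnsalYaffe2008, §1 (p. 3: "absolute squares of Wilson loops with non-zero N-ality")] -/
theorem ekPolyakovSq_centerFlip (μ : Fin d) (U : EKConfig d N) :
    ekPolyakovSq (centerFlip μ U) = ekPolyakovSq U := by
  unfold ekPolyakovSq
  refine Finset.sum_congr rfl fun ν _ => ?_
  by_cases h : ν = μ
  · subst h; rw [openLine_centerFlip, norm_neg]
  · rw [openLine_centerFlip_ne h]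

/-- **The deformed weight is centre symmetric** — the deformation removes none of the structure
(exact `U(1)^d` symmetry of measure and weight) on which the barrier's `because:` clause rests;
what it changes is the weight of the collapsed configurations. [cite: UnsalYaffe2008, §2.1 (p. 4)] -/
theorem ekDeformedWeight_centerFlip (N : ℕ) (b h : ℝ) (μ : Fin d) (U : EKConfig d N) :
    ekDeformedWeight N b h (centerFlip μ U) = ekDeformedWeight N b h U := by
  rw [ekDeformedWeight, ekDeformedWeight, ekAction_centerFlip, ekPolyakovSq_centerFlip]

/-! ### Elementary bounds: open lines, the traceless diagonal vacuum -/

/-- `|(1/N) tr U_μ| ≤ 1` (entries of a unitary are bounded by its operator norm `1`). [folklore] -/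
theorem norm_openLine_le_one (μ : Fin d) (U : EKConfig d N) : ‖openLine μ U‖ ≤ 1 := by
  unfold openLine
  rcases Nat.eq_zero_or_pos N with hN | hN
  · subst hN
    simp [Matrix.trace]
  · haveI : Nonempty (Fin N) := ⟨⟨0, hN⟩⟩
    have hN' : (0 : ℝ) < N := by exact_mod_cast hN
    rw [norm_div, Complex.norm_natCast, div_le_one hN']
    calc ‖Matrix.trace (U μ : Matrix (Fin N) (Fin N) ℂ)‖
        = ‖∑ i, (U μ : Matrix (Fin N) (Fin N) ℂ) i i‖ := rfl
      _ ≤ ∑ i, ‖(U μ : Matrix (Fin N) (Fin N) ℂ) i i‖ := norm_sum_le _ _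
      _ ≤ ∑ _i : Fin N, ‖(U μ : Matrix (Fin N) (Fin N) ℂ)‖ :=
          Finset.sum_le_sum fun i _ => norm_entry_le_l2_opNorm _ i i
      _ = N := by rw [CStarRing.norm_coe_unitary (U μ)]; simp

/-- `P[U] ≤ ε` forces every `|openLine|² ≤ ε`; in particular `|openLine|² ≤ 1` always. [folklore] -/
theorem sq_norm_openLine_le_one (μ : Fin d) (U : EKConfig d N) : ‖openLine μ U‖ ^ 2 ≤ 1 := by
  have h := norm_openLine_le_one μ U
  have h0 := norm_nonneg (openLine μ U)
  nlinarith

/-- The alternating-sign diagonal unitary `diag((−1)^i)` has `|tr| ≤ 1` for EVERY `N` (trace `0`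
for even `N`, `1` for odd `N`). [folklore] -/
theorem norm_trace_signDiag_le_one (N : ℕ) :
    ‖Matrix.trace ((signDiag N : UN N) : Matrix (Fin N) (Fin N) ℂ)‖ ≤ 1 := by
  show ‖Matrix.trace (Matrix.diagonal fun i : Fin N => ((-1 : ℂ) ^ (i : ℕ)))‖ ≤ 1
  rw [Matrix.trace_diagonal, Fin.sum_univ_eq_sum_range (fun i => (-1 : ℂ) ^ i) N,
    neg_one_geom_sum]
  split_ifs <;> simp

/-- Near the traceless diagonal vacuum the open lines are small:
if `‖U_μ − diag(±1)‖_op ≤ η` then `|(1/N) tr U_μ| ≤ 1/N + η`. [folklore] -/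
theorem norm_openLine_le_of_near_signDiag (hN : 0 < N) {η : ℝ} (U : EKConfig d N) (μ : Fin d)
    (hU : ‖(U μ : Matrix (Fin N) (Fin N) ℂ) - ((signDiag N : UN N) : Matrix (Fin N) (Fin N) ℂ)‖ ≤ η) :
    ‖openLine μ U‖ ≤ 1 / N + η := by
  have hN' : (0 : ℝ) < N := by exact_mod_cast hN
  have h := norm_openLine_le_of_near hN (signDiag N) U μ
  have htr : ‖Matrix.trace ((signDiag N : UN N) : Matrix (Fin N) (Fin N) ℂ) / (N : ℂ)‖ ≤ 1 / N := by
    rw [norm_div, Complex.norm_natCast]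
    exact div_le_div_of_nonneg_right (norm_trace_signDiag_le_one N) hN'.le
  linarith

/-- The operator-norm ball of radius `η` around a unitary `D`, as the left translate of the ball
around `1`: membership gives `‖V − D‖_op ≤ η`. [folklore] -/
theorem norm_sub_le_of_inv_mul_mem_unitaryOpBall (hN : 0 < N) (D : UN N) {η : ℝ} {V : UN N}
    (hV : D⁻¹ * V ∈ unitaryOpBall N η) :
    ‖(V : Matrix (Fin N) (Fin N) ℂ) - (D : Matrix (Fin N) (Fin N) ℂ)‖ ≤ η := by
  haveI : Nonempty (Fin N) := ⟨⟨0, hN⟩⟩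
  have hV' : ‖((D⁻¹ * V : UN N) : Matrix (Fin N) (Fin N) ℂ) - 1‖ ≤ η := hV
  have hDD : (D : Matrix (Fin N) (Fin N) ℂ) * star (D : Matrix (Fin N) (Fin N) ℂ) = 1 :=
    Unitary.coe_mul_star_self D
  have hfac : (V : Matrix (Fin N) (Fin N) ℂ) - (D : Matrix (Fin N) (Fin N) ℂ) =
      (D : Matrix (Fin N) (Fin N) ℂ) * (((D⁻¹ * V : UN N) : Matrix (Fin N) (Fin N) ℂ) - 1) := by
    show _ = (D : Matrix (Fin N) (Fin N) ℂ) *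
      (star (D : Matrix (Fin N) (Fin N) ℂ) * (V : Matrix (Fin N) (Fin N) ℂ) - 1)
    rw [mul_sub, ← mul_assoc, hDD, one_mul, mul_one]
  rw [hfac]
  calc _ ≤ ‖(D : Matrix (Fin N) (Fin N) ℂ)‖ * ‖((D⁻¹ * V : UN N) : Matrix (Fin N) (Fin N) ℂ) - 1‖ :=
        norm_mul_le _ _
    _ ≤ 1 * η := by rw [CStarRing.norm_coe_unitary D]; gcongr
    _ = η := one_mul η

/-! ### The finite-`N` bound -/

/-- **Pointwise splitting.** For `b, h ≥ 0` and `ε > 0`: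
`|openLine_μ|² · w_{b,h} ≤ ε · w_{b,h} + e^{−N² h ε}` (on `{P ≤ ε}` use `|openLine_μ|² ≤ P`; on
`{P > ε}` use `|openLine_μ|² ≤ 1` and `w_{b,h} ≤ e^{−N² h P}`). [folklore] -/
theorem sq_norm_openLine_mul_weight_le (N : ℕ) {b h ε : ℝ} (hb : 0 ≤ b) (hh : 0 ≤ h) (hε : 0 ≤ ε)
    (μ : Fin d) (U : EKConfig d N) :
    ‖openLine μ U‖ ^ 2 * ekDeformedWeight N b h U ≤
      ε * ekDeformedWeight N b h U + Real.exp (-((N : ℝ) ^ 2 * h * ε)) := by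
  have hw0 : 0 < ekDeformedWeight N b h U := ekDeformedWeight_pos N b h U
  have hexp0 : 0 < Real.exp (-((N : ℝ) ^ 2 * h * ε)) := Real.exp_pos _
  rcases le_or_gt (ekPolyakovSq U) ε with hP | hP
  · have h1 : ‖openLine μ U‖ ^ 2 ≤ ε := (sq_norm_openLine_le_ekPolyakovSq U μ).trans hP
    nlinarith [mul_le_mul_of_nonneg_right h1 hw0.le]
  · have h1 : ‖openLine μ U‖ ^ 2 * ekDeformedWeight N b h U ≤ ekDeformedWeight N b h U := by
      have := sq_norm_openLine_le_one μ U
      nlinarith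
    have h2 : ekDeformedWeight N b h U ≤ Real.exp (-((N : ℝ) ^ 2 * h * ε)) := by
      refine (ekDeformedWeight_le_exp N hb U).trans ?_
      rw [Real.exp_le_exp]
      have : (N : ℝ) ^ 2 * h * ε ≤ (N : ℝ) ^ 2 * h * ekPolyakovSq U :=
        mul_le_mul_of_nonneg_left hP.le (by positivity)
      linarith
    nlinarith

/-- **Numerator bound**: `∫ |openLine_μ|² w_{b,h} ≤ ε Z_{b,h} + e^{−N² h ε}`. [folklore] -/
theorem integral_sq_norm_openLine_mul_weight_le (N : ℕ) {b h ε : ℝ} (hb : 0 ≤ b) (hh : 0 ≤ h)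
    (hε : 0 ≤ ε) (μ : Fin d) :
    ∫ U, ‖openLine μ U‖ ^ 2 * ekDeformedWeight N b h U ∂ekHaar d N ≤
      ε * ∫ U, ekDeformedWeight N b h U ∂ekHaar d N + Real.exp (-((N : ℝ) ^ 2 * h * ε)) := by
  have hint1 : Integrable (fun U : EKConfig d N => ‖openLine μ U‖ ^ 2 * ekDeformedWeight N b h U)
      (ekHaar d N) :=
    integrable_of_continuous_config
      (((continuous_openLine μ).norm.pow 2).mul (continuous_ekDeformedWeight N b h))
  have hint2 : Integrable (fun U : EKConfig d N =>
      ε * ekDeformedWeight N b h U + Real.exp (-((N : ℝ) ^ 2 * h * ε))) (ekHaar d N) :=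
    ((integrable_ekDeformedWeight N b h).const_mul ε).add (integrable_const _)
  calc ∫ U, ‖openLine μ U‖ ^ 2 * ekDeformedWeight N b h U ∂ekHaar d N
      ≤ ∫ U, (ε * ekDeformedWeight N b h U + Real.exp (-((N : ℝ) ^ 2 * h * ε))) ∂ekHaar d N :=
        integral_mono hint1 hint2 fun U => sq_norm_openLine_mul_weight_le N hb hh hε μ U
    _ = ε * ∫ U, ekDeformedWeight N b h U ∂ekHaar d N + Real.exp (-((N : ℝ) ^ 2 * h * ε)) := by
        rw [integral_add ((integrable_ekDeformedWeight N b h).const_mul ε) (integrable_const _),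
          integral_const_mul, integral_const, smul_eq_mul, probReal_univ, one_mul]

/-- **Denominator bound: the deformed partition function from the centre-symmetric vacuum.**
For `N ≥ 1`, `b, h ≥ 0`, `0 < η ≤ 1`:
`Z_{b,h} ≥ exp(−N²(4 b d² η² + h d (1/N + η)² + d log((2π+1)/η)))` — restrict to the box
`∏_μ {‖U_μ − diag(±1)‖_op ≤ η}`, where `S_R ≤ 4d²η²`, `P ≤ d(1/N + η)²`, and whose product-Haar
measure is `≥ (η/(2π+1))^{dN²}`. [folklore] -/
theorem ekDeformedPartition_ge (hN : 0 < N) {b h η : ℝ} (hb : 0 ≤ b) (hh : 0 ≤ h) (hη : 0 < η)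
    (hη1 : η ≤ 1) :
    Real.exp (-((N : ℝ) ^ 2 * (4 * b * (d : ℝ) ^ 2 * η ^ 2 + h * d * (1 / N + η) ^ 2 +
        d * Real.log ((2 * π + 1) / η)))) ≤ ∫ U, ekDeformedWeight N b h U ∂ekHaar d N := by
  have hN' : (0 : ℝ) < N := by exact_mod_cast hN
  set D : UN N := signDiag N with hD
  set ballD : Set (UN N) := (fun V => D⁻¹ * V) ⁻¹' unitaryOpBall N η with hballD
  have hballD_meas : MeasurableSet ballD :=
    (measurableSet_unitaryOpBall η).preimage (measurable_const_mul _)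
  set Box : Set (EKConfig d N) := Set.pi Set.univ fun _ : Fin d => ballD with hBox
  have hBox_meas : MeasurableSet Box := MeasurableSet.univ_pi fun _ => hballD_meas
  have hBox_fin : ekHaar d N Box ≠ ⊤ := measure_ne_top _ _
  -- the weight on the box
  set c : ℝ := Real.exp (-((N : ℝ) ^ 2 * (4 * b * (d : ℝ) ^ 2 * η ^ 2 + h * d * (1 / N + η) ^ 2)))
    with hc
  have hw : ∀ U ∈ Box, c ≤ ekDeformedWeight N b h U := by
    intro U hU
    have hU' : ∀ μ, ‖(U μ : Matrix (Fin N) (Fin N) ℂ) - (D : Matrix (Fin N) (Fin N) ℂ)‖ ≤ η :=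
      fun μ => norm_sub_le_of_inv_mul_mem_unitaryOpBall hN D (hU μ (Set.mem_univ μ))
    have hS : ekAction U ≤ 4 * (d : ℝ) ^ 2 * η ^ 2 := ekAction_le_of_near_const hN D U hU'
    have hP : ekPolyakovSq U ≤ d * (1 / N + η) ^ 2 := by
      have hline : ∀ μ, ‖openLine μ U‖ ^ 2 ≤ (1 / N + η) ^ 2 := fun μ =>
        pow_le_pow_left₀ (norm_nonneg _) (norm_openLine_le_of_near_signDiag hN U μ (hU' μ)) 2
      calc ekPolyakovSq U = ∑ μ, ‖openLine μ U‖ ^ 2 := rfl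
        _ ≤ ∑ _μ : Fin d, (1 / (N : ℝ) + η) ^ 2 := Finset.sum_le_sum fun μ _ => hline μ
        _ = d * (1 / N + η) ^ 2 := by simp
    rw [hc, ekDeformedWeight, Real.exp_le_exp]
    have h1 : (N : ℝ) ^ 2 * b * ekAction U ≤ (N : ℝ) ^ 2 * b * (4 * (d : ℝ) ^ 2 * η ^ 2) :=
      mul_le_mul_of_nonneg_left hS (by positivity)
    have h2 : (N : ℝ) ^ 2 * h * ekPolyakovSq U ≤ (N : ℝ) ^ 2 * h * (d * (1 / N + η) ^ 2) :=
      mul_le_mul_of_nonneg_left hP (by positivity)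
    nlinarith
  -- the measure of the box
  have hvol : ENNReal.ofReal (((η / (2 * π + 1)) ^ (N * N)) ^ d) ≤ ekHaar d N Box := by
    rw [hBox]
    unfold ekHaar
    rw [Measure.pi_pi,
      show (((η / (2 * π + 1)) ^ (N * N)) ^ d) = ∏ _μ : Fin d, (η / (2 * π + 1)) ^ (N * N) by simp,
      ENNReal.ofReal_prod_of_nonneg (fun _ _ => by positivity)]
    refine Finset.prod_le_prod' fun μ _ => ?_
    rw [hballD, measure_preimage_mul]
    refine le_trans (ENNReal.ofReal_le_ofReal ?_) (haar_unitaryOpBall_ge _ hη)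
    gcongr
  have hreal : ((η / (2 * π + 1)) ^ (N * N)) ^ d ≤ (ekHaar d N).real Box := by
    rw [measureReal_def, ← ENNReal.ofReal_le_iff_le_toReal hBox_fin]
    exact hvol
  -- the integral over the box
  have hint : c * (ekHaar d N).real Box ≤ ∫ U, ekDeformedWeight N b h U ∂ekHaar d N := by
    calc c * (ekHaar d N).real Box
        ≤ ∫ U in Box, ekDeformedWeight N b h U ∂ekHaar d N :=
          setIntegral_ge_of_const_le_real hBox_meas hBox_fin hw
            (integrable_ekDeformedWeight N b h).integrableOn
      _ ≤ ∫ U, ekDeformedWeight N b h U ∂ekHaar d N :=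
          setIntegral_le_integral (integrable_ekDeformedWeight N b h)
            (Eventually.of_forall fun U => (Real.exp_pos _).le)
  -- the target as c · (η/(2π+1))^{N² d}
  have hπ : 0 < 2 * π + 1 := by positivity
  have hq : 0 < η / (2 * π + 1) := div_pos hη hπ
  have htarget : Real.exp (-((N : ℝ) ^ 2 * (4 * b * (d : ℝ) ^ 2 * η ^ 2 + h * d * (1 / N + η) ^ 2 +
      d * Real.log ((2 * π + 1) / η)))) = c * ((η / (2 * π + 1)) ^ (N * N)) ^ d := by
    rw [← pow_mul, ← Real.exp_log (pow_pos hq (N * N * d)), hc, ← Real.exp_add, Real.log_pow,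
      Real.log_div hη.ne' hπ.ne', Real.log_div hπ.ne' hη.ne']
    congr 1
    push_cast
    ring
  rw [htarget]
  calc c * ((η / (2 * π + 1)) ^ (N * N)) ^ d ≤ c * (ekHaar d N).real Box := by
        have hc0 : 0 ≤ c := (Real.exp_pos _).le
        exact mul_le_mul_of_nonneg_left hreal hc0
    _ ≤ ∫ U, ekDeformedWeight N b h U ∂ekHaar d N := hint

/-- **Finite-`N` bound on the deformed order parameter.** For `N ≥ 1`, `b, h ≥ 0`, `ε > 0`,
`0 < η ≤ 1` and every direction `μ`:
`⟨|(1/N) tr U_μ|²⟩_{b,h} ≤ ε + exp(−N²(h ε − h d (1/N + η)² − 4 b d² η² − d log((2π+1)/η)))`.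
[folklore] -/
theorem ekDeformedOrderParameter_le (hN : 0 < N) {b h ε η : ℝ} (hb : 0 ≤ b) (hh : 0 ≤ h)
    (hε : 0 < ε) (hη : 0 < η) (hη1 : η ≤ 1) (μ : Fin d) :
    ekDeformedOrderParameter d N b h μ ≤
      ε + Real.exp (-((N : ℝ) ^ 2 * (h * ε - h * d * (1 / N + η) ^ 2 - 4 * b * (d : ℝ) ^ 2 * η ^ 2 -
        d * Real.log ((2 * π + 1) / η)))) := by
  unfold ekDeformedOrderParameter ekDeformedExpectation
  set Z : ℝ := ∫ U, ekDeformedWeight N b h U ∂ekHaar d N with hZ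
  have hZpos : 0 < Z := ekDeformedPartition_pos d N b h
  set K : ℝ := 4 * b * (d : ℝ) ^ 2 * η ^ 2 + h * d * (1 / N + η) ^ 2 +
    d * Real.log ((2 * π + 1) / η) with hK
  have hZge : Real.exp (-((N : ℝ) ^ 2 * K)) ≤ Z := ekDeformedPartition_ge hN hb hh hη hη1
  have hnum := integral_sq_norm_openLine_mul_weight_le (d := d) N hb hh hε.le μ
  have hexp0 : 0 ≤ Real.exp (-((N : ℝ) ^ 2 * h * ε)) := (Real.exp_pos _).le
  calc (∫ U, ‖openLine μ U‖ ^ 2 * ekDeformedWeight N b h U ∂ekHaar d N) / Z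
      ≤ (ε * Z + Real.exp (-((N : ℝ) ^ 2 * h * ε))) / Z :=
        div_le_div_of_nonneg_right hnum hZpos.le
    _ = ε + Real.exp (-((N : ℝ) ^ 2 * h * ε)) / Z := by
        rw [add_div, mul_div_assoc, div_self hZpos.ne', mul_one]
    _ ≤ ε + Real.exp (-((N : ℝ) ^ 2 * h * ε)) / Real.exp (-((N : ℝ) ^ 2 * K)) := by
        gcongr
    _ = ε + Real.exp (-((N : ℝ) ^ 2 * (h * ε - h * d * (1 / N + η) ^ 2 -
          4 * b * (d : ℝ) ^ 2 * η ^ 2 - d * Real.log ((2 * π + 1) / η)))) := by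
        rw [← Real.exp_sub, hK]
        congr 1
        ring

/-! ### The evasion: at every coupling, large deformation makes the open lines small, uniformly in `N` -/

/-- **Centre stabilisation at every coupling (proved).** For every dimension `d`, every inverse
't Hooft coupling `b ≥ 0` and every `ε > 0` there is a deformation strength `h₀` (explicitly
`h₀ = 4(K + 1)/ε`, `K = 4 b d² η² + d log((2π+1)/η)`, `η = min 1 (ε/(16d + 1))`) such that for all
`h ≥ h₀`, in every direction, the open-line order parameter of the deformed single-site model is
`≤ ε` for all sufficiently large `N`. In Ünsal–Yaffe's words, a `|tr Ω|²` term "with a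
sufficiently large positive coefficient … would prevent breaking of the center symmetry with
`⟨tr Ω⟩` as an order parameter" — here as an `N`-uniform theorem about the integrals, at the price
of `h₀` depending on `b` and `ε`. [cite: UnsalYaffe2008, §1 (p. 3), §2.1 (p. 4)] -/
theorem ekDeformed_openLines_eventually_le (d : ℕ) {b ε : ℝ} (hb : 0 ≤ b) (hε : 0 < ε) :
    ∃ h₀ : ℝ, 0 ≤ h₀ ∧ ∀ h : ℝ, h₀ ≤ h → ∀ μ : Fin d,
      ∀ᶠ N : ℕ in atTop, ekDeformedOrderParameter d N b h μ ≤ ε := by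
  have hd0 : (0 : ℝ) ≤ d := Nat.cast_nonneg d
  -- the scale η
  set η : ℝ := min 1 (ε / (16 * d + 1)) with hη
  have h16 : (0 : ℝ) < 16 * d + 1 := by positivity
  have hηpos : 0 < η := lt_min one_pos (div_pos hε h16)
  have hη1 : η ≤ 1 := min_le_left _ _
  have hηε : η ≤ ε / (16 * d + 1) := min_le_right _ _
  have hdη : (d : ℝ) * η ^ 2 ≤ ε / 16 := by
    have h1 : (d : ℝ) * η ^ 2 ≤ d * η := by
      have : η ^ 2 ≤ η := by nlinarith
      exact mul_le_mul_of_nonneg_left this hd0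
    have h2 : (d : ℝ) * η ≤ d * (ε / (16 * d + 1)) := mul_le_mul_of_nonneg_left hηε hd0
    have h3 : (d : ℝ) * (ε / (16 * d + 1)) ≤ ε / 16 := by
      rw [mul_div_assoc', div_le_div_iff₀ h16 (by norm_num : (0 : ℝ) < 16)]
      nlinarith
    linarith
  -- the constant K and the threshold h₀
  set K : ℝ := 4 * b * (d : ℝ) ^ 2 * η ^ 2 + d * Real.log ((2 * π + 1) / η) with hK
  have hlog : 0 ≤ Real.log ((2 * π + 1) / η) := by
    refine Real.log_nonneg ?_
    rw [le_div_iff₀ hηpos, one_mul]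
    have : (1 : ℝ) ≤ 2 * π + 1 := by have := Real.pi_pos; linarith
    linarith
  have hK0 : 0 ≤ K := by positivity
  refine ⟨4 * (K + 1) / ε, by positivity, fun h hh μ => ?_⟩
  have hh0 : 0 ≤ h := le_trans (by positivity) hh
  have hhε : K + 1 ≤ h * ε / 4 := by
    rw [div_le_iff₀ hε] at hh
    linarith
  -- the three eventualities in N
  have hε2 : (0 : ℝ) < ε / 2 := by linarith
  have e1 : ∀ᶠ N : ℕ in atTop, Real.exp (-((N : ℝ) ^ 2)) ≤ ε / 2 :=
    tendsto_exp_neg_sq.eventually_le_const hε2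
  have e2 : ∀ᶠ N : ℕ in atTop, ⌈1 / η⌉₊ ≤ N := eventually_ge_atTop _
  have e3 : ∀ᶠ N : ℕ in atTop, 1 ≤ N := eventually_ge_atTop 1
  filter_upwards [e1, e2, e3] with N hN1 hN2 hN3
  have hNpos : 0 < N := hN3
  have hN' : (0 : ℝ) < N := by exact_mod_cast hNpos
  -- 1/N ≤ η
  have hinv : 1 / (N : ℝ) ≤ η := by
    have hc : (1 / η : ℝ) ≤ N := (Nat.le_ceil (1 / η)).trans (by exact_mod_cast hN2)
    rw [div_le_iff₀ hηpos] at hc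
    rw [div_le_iff₀ hN']
    linarith
  -- the finite-N bound at ε/2
  have hmain := ekDeformedOrderParameter_le (d := d) hNpos hb hh0 hε2 hηpos hη1 μ
  -- the exponent is at least N²
  have hsq : (1 / (N : ℝ) + η) ^ 2 ≤ 4 * η ^ 2 := by
    have h0 : 0 ≤ 1 / (N : ℝ) := by positivity
    nlinarith
  have hterm : h * d * (1 / (N : ℝ) + η) ^ 2 ≤ h * ε / 4 := by
    calc h * d * (1 / (N : ℝ) + η) ^ 2 ≤ h * d * (4 * η ^ 2) :=
          mul_le_mul_of_nonneg_left hsq (by positivity)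
      _ = 4 * h * (d * η ^ 2) := by ring
      _ ≤ 4 * h * (ε / 16) := mul_le_mul_of_nonneg_left hdη (by positivity)
      _ = h * ε / 4 := by ring
  have hinner : 1 ≤ h * (ε / 2) - h * d * (1 / (N : ℝ) + η) ^ 2 - 4 * b * (d : ℝ) ^ 2 * η ^ 2 -
      d * Real.log ((2 * π + 1) / η) := by
    have : h * (ε / 2) - h * d * (1 / (N : ℝ) + η) ^ 2 - 4 * b * (d : ℝ) ^ 2 * η ^ 2 -
        d * Real.log ((2 * π + 1) / η) = h * (ε / 2) - h * d * (1 / (N : ℝ) + η) ^ 2 - K := by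
      rw [hK]; ring
    rw [this]
    linarith
  have hexp : Real.exp (-((N : ℝ) ^ 2 * (h * (ε / 2) - h * d * (1 / (N : ℝ) + η) ^ 2 -
      4 * b * (d : ℝ) ^ 2 * η ^ 2 - d * Real.log ((2 * π + 1) / η)))) ≤
      Real.exp (-((N : ℝ) ^ 2)) := by
    rw [Real.exp_le_exp]
    have hN2 : (0 : ℝ) ≤ (N : ℝ) ^ 2 := by positivity
    nlinarith [mul_le_mul_of_nonneg_left hinner hN2]
  linarith

/-- **The contrast with the barrier, inside one family of single-site models.** Under the named
fact `EguchiKawaiBreakdown`, for every `d ≥ 3` there is `b₀` such that at every weaker coupling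
`b > b₀`: (i) the `h = 0` member of the family `e^{−N² b S_R − N² h Σ_μ|tr U_μ/N|²} ∏ dU_μ` — the
Eguchi–Kawai model of the barrier — has its open-line order parameter NOT tending to `0` in some
direction, while (ii) for every `ε > 0` all members with `h ≥ h₀(b, ε)` have it eventually `≤ ε`
in every direction, (ii) being unconditional (`ekDeformed_openLines_eventually_le`). The
`U(1)^d` breakdown is an obstruction to the undeformed Wilson-type single-site action (14.38),
not to single-site large-`N` reduction with a centre-stabilised action. [cite: UnsalYaffe2008, §1 (p. 4: "Unlike the original Eguchi-Kawai model … irrespective of the value of the (bare) gauge coupling")] [cite: Makeenko2023, §14.3 (PDF p. 246)] -/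
theorem ekDeformed_contrast (hEK : EguchiKawaiBreakdown) {d : ℕ} (hd : 3 ≤ d) :
    ∃ b₀ : ℝ, 0 ≤ b₀ ∧ ∀ b : ℝ, b₀ < b →
      (∃ μ : Fin d, ¬ Tendsto (fun N : ℕ => ekDeformedOrderParameter d N b 0 μ) atTop (𝓝 0)) ∧
      (∀ ε : ℝ, 0 < ε → ∃ h₀ : ℝ, 0 ≤ h₀ ∧ ∀ h : ℝ, h₀ ≤ h → ∀ μ : Fin d,
        ∀ᶠ N : ℕ in atTop, ekDeformedOrderParameter d N b h μ ≤ ε) := by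
  obtain ⟨b₀, hb₀, H⟩ := hEK d hd
  refine ⟨b₀, hb₀, fun b hb => ⟨?_, fun ε hε => ?_⟩⟩
  · obtain ⟨μ, hμ⟩ := H b hb
    refine ⟨μ, fun ht => hμ ?_⟩
    exact ht.congr fun N => ekDeformedOrderParameter_zero_right d N b μ
  · exact ekDeformed_openLines_eventually_le d (hb₀.trans hb.le) hε

end Literature.Barriers.QuantumFields

end
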